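import Summits.QuantumFields.BalabanUV.T4Continuum.Support.NE7ApeFlatToronEnd
import Summits.QuantumFields.BalabanUV.T4Continuum.Support.NE7CentralTwist
import Summits.QuantumFields.BalabanUV.T4Continuum.Support.NE7AxisHolonomyRecurrence
import HarnessLib

/-!
# NE7ApeFlatToronCentralEnd — (APE) ON THE FIBRE OVER A FLAT DATUM WHOSE HOLONOMY HAS FINITE ORDER MODULO THE CENTRE: the `(N·m)`-fold axis
# holonomies of the datum are SCALARS `c_i·1` (not necessarily `1`); the central part is absorbed by a constant scalar twist of the fine
# configuration (`NE7CentralTwist`), the rest is (D9)'s intrinsic form — SAME constants as the OWNER's END at the trivial datum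

Cell `pub-balaban`, rung (B)+1 sub-cell t4, lineage `b2b-balaban-t4-ne7-p2`, generation 89 (CRUX PROVER NE7 #2 = co-owner of row NE7, kernel hand); file (D11)
of the gen-89 line, over (D9) `NE7ApeFlatToronEnd.smallField_of_tanCritical_flatDatum` (this lineage, over the OWNER's D8
`NE7ApeTrivialFlatEndCritical.smallField_of_tanCritical_flatTop`, t4-ne7-p1 g74), (B) `NE7SmallFieldBootstrap` (the bootstrap iteration), (C4)
`NE7CentralTwist` and (R) `NE7AxisHolonomyRecurrence` (axis holonomies on covers are powers).
THE ARGUMENT.  Let `D = cavgIter L (k+1) U` be flat with `D([0,(N·m)e_i]) = c_i·1`, `|c_i| = 1`.  Put `t_i := −arg c_i ∕ (N·m·M)`, `a_i := i t_i`, `z = e^{a}·1`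
and `U′ := U·z` (`M = L^{k+1}`).  By (C4): `U′` is unitary and periodic with the plaquette variables, the small-field radii, the linearised tower `dirIter`
and the first variation `dAction` OF `U` (so tangent-criticality transfers verbatim), and `cavgIter L (k+1) U′ = D·e^{M a}·1`, which is flat with axis
holonomies `c_i·e^{(N·m)·M·a_i}·1 = c_i e^{−i arg c_i}·1 = 1`.  (D9) §4 applied to `U′` gives `SmallField U′ (K′δ²∕M²) = SmallField U (K′δ²∕M²)`.
WHAT ([folklore]; 0 def, 0 sorry).  §1 `axis_holonomy_killed` (`e^{i arg c} = c` for `|c| = 1` is Mathlib's `Complex.norm_mul_exp_arg_mul_I`); §2 **`smallField_of_tanCritical_flatDatumCentral`**: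
D8's `∃ K′ θ` clause; hypotheses = D9 §4's with `hol D 0 (seg i (N·m)) = 1` WEAKENED to `= c_i·1`, `|c_i| = 1`.  §3 (the bootstrap iteration (B) over §2, as D9 §4)
**`smallField_zero_of_tanCritical_flatDatumCentral`** (`∃ θ₀ > 0`: the same hypotheses with `δ ≤ θ₀` ⟹ `SmallField U 0`) and
**`exists_pureGauge_of_tanCritical_flatDatumCentral`** (⟹ `∃ g` unitary, `U = 1^{g}`): on these fibres the tangent-critical points of the small-field class are
exactly the pure gauges.  §4 the same two ENDs with the hypothesis put on the period-`N` axis holonomies `h_i = D([0,N e_i])`: `h_i^m = c_i·1` (finite order `m`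
MODULO THE CENTRE; `NE7AxisHolonomyRecurrence.hol_seg_mul_eq_pow`: `D([0,(N·m)e_i]) = h_i^m` for the `N`-periodic datum):
**`smallField_of_tanCritical_flatDatumPU`**,
**`exists_pureGauge_of_tanCritical_flatDatumPU`**.  §5 `U(1)` (`Unique n`): every holonomy is a unimodular scalar (`exists_eq_smul_one_of_unique`),
so **`smallField_of_tanCritical_flatDatum_abelian`** is the END over EVERY flat datum, no holonomy hypothesis, and
**`exists_pureGauge_of_tanCritical_flatDatum_abelian`** the rigidity there.
REACH after this file: the (APE) END holds on the fibre over every flat datum whose holonomy constants have finite order IN `PU(n)` (for `U(1)`: every flat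
datum).  NOT reached: infinite order modulo the centre — reduced by (T′) `NE7ApeFlatEndOfRobustEnd` ∕ (T″) `NE7ApeFlatEndOfRobustConst` to a ROBUST END at
constant commuting data (open); curved data ((c), [B9]).
HONEST FRAMING (page 1): composition BY NAME + scalar bookkeeping; nothing of Bałaban's asserted; (APE) on the data class `𝒟_β` NOT proved; NE7 NOT PRINTED ∕
NOT PROVED; spine PROVED 0∕9; FIXED FINITE T⁴, rung (B)+1 — NOT infinite volume, NOT mass gap, NOT BetaPertH, NOT Clay.  Continuum YM on T⁴ ⇐ BetaPertH ∧ nine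
spine estimates (0/9 proved); BetaPertH ⇐ (D1) ∧ (D4) ∧ CAP+tail; G-an2-4 gates asym, D1 and NE2/3/4.
-/

set_option autoImplicit false

open scoped BigOperators Matrix.Norms.L2Operator
open NormedSpace Finset

namespace Summit.QuantumFields.BalabanUV.T4Continuum.NE7ApeFlatToronCentralEnd

open Literature.MathematicalPhysics.QuantumFieldTheory.Balaban1983to89
open B7Prop1Explicit B7Prop2Explicit
open T4AveragingDeficitWall (IsUnitaryCfg IsSkewDir SmallField)
open T4AveragingDeficitWallBoundary (IsPeriodicCfg scalarCfg)
open AveragingDeficitPeriodicCounting (IsPeriodicDir)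
open AveragingDeficitMultiLevelPrep (cavgIter LevelSmall isPeriodicCfg_cavgIter cavgIter_unitary_small)
open MinimalActionLevels (perWin)
open NE3HessForm (dAction)
open NE3TangentCovariantTower (dirIter)
open NE3QbarIterCovLiftPrep (cruxC)
open NE3RightInverseSolveLetters (thetaLoc)
open NE7ApeFlatToronEnd (smallField_of_tanCritical_flatDatum)
open NE3FramePotBoundW (tower_eq_pow_mul)
open NE7AxisHolonomyRecurrence (hol_seg_mul_eq_pow)
open NE7SmallFieldBootstrap (smallField_zero_of_bootstrap hol_plaqWord_eq_one_of_smallField_zero)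
open NE3EnergyRateFlatClass (exists_unitary_gauge_eq_gaugeAct_flatCfg)
open NE3EnergyShapes (IsUnitarySite)
open BlockAveragePushDirSplit (flat)
open NE7CentralTwist
open FederbushMean (cexp_smul_one)

noncomputable section

variable {d : ℕ} {n : Type*} [Fintype n] [DecidableEq n]

/-! ## §1 Scalar bookkeeping: the central part of an axis holonomy is killed by the twist -/

/-- **THE AXIS HOLONOMY IS KILLED**: with `t = −arg c ∕ Q` (`Q ≠ 0` real), `c · e^{Q·(t i)} = 1`. [folklore] -/
theorem axis_holonomy_killed {c : ℂ} (hc : ‖c‖ = 1) {Q : ℝ} (hQ : Q ≠ 0) :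
    c * Complex.exp ((Q : ℂ) * ((((-Complex.arg c / Q : ℝ)) : ℂ) * Complex.I)) = 1 := by
  have h1 : (Q : ℂ) * ((((-Complex.arg c / Q : ℝ)) : ℂ) * Complex.I) = -((Complex.arg c : ℂ) * Complex.I) := by
    have hQ' : (Q : ℂ) ≠ 0 := by exact_mod_cast hQ
    push_cast
    field_simp
  have hexp : Complex.exp ((Complex.arg c : ℂ) * Complex.I) = c := by
    have h := Complex.norm_mul_exp_arg_mul_I c
    rwa [hc, Complex.ofReal_one, one_mul] at h
  rw [h1, Complex.exp_neg, hexp]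
  have hc0 : c ≠ 0 := by
    intro h; rw [h, norm_zero] at hc; exact zero_ne_one hc
  exact mul_inv_cancel₀ hc0

/-! ## §2 THE END ON THE FIBRE OVER A FLAT DATUM WITH HOLONOMY OF FINITE ORDER MODULO THE CENTRE -/

/-- **(APE) ON THE FIBRE OVER A FLAT DATUM WHOSE `(N·m)`-FOLD AXIS HOLONOMIES ARE SCALARS.**  `∃ K′ θ > 0` (D8's clause): for all `N, m ≥ 1`, `k`, every unitary
`(L^{k+1}N)`-periodic `U` of the multi-level class whose `(k+1)`-fold average `D` is FLAT with `D([0,(N·m)e_i]) = c_i·1`, `|c_i| = 1`, `SmallField U (δ∕M²)`,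
`0 ≤ δ ≤ θ`, `δ∕M² ≤ x`, tangent-critical at period `L^{k+1}N`: `SmallField U (K′δ²∕M²)`. [folklore] -/
theorem smallField_of_tanCritical_flatDatumCentral {n : Type} [Fintype n] [DecidableEq n] [Nonempty n] (hd : 1 ≤ d) {L : ℕ} (hL : 2 ≤ L) :
    ∃ K' θ : ℝ, 0 < K' ∧ 0 < θ ∧ ∀ (N : ℕ) [NeZero N] (m : ℕ) [NeZero m] (k : ℕ)
      {U : Site (d + 1) → Fin (d + 1) → (Matrix n n ℂ)ˣ} (_hU : IsUnitaryCfg U) {x δ : ℝ} (_hx : 0 ≤ x) (_hs : LevelSmall (d + 1) L k x)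
      (_hUx : SmallField U x) (_hδ : 0 ≤ δ) (_hUδ : SmallField U (δ / ((L : ℝ) ^ (k + 1)) ^ 2)) (_hδx : δ / ((L : ℝ) ^ (k + 1)) ^ 2 ≤ x)
      (_hcritU : ∀ φ : Site (d + 1) → Fin (d + 1) → Matrix n n ℂ, IsSkewDir φ → IsPeriodicDir φ ((L ^ (k + 1) * N : ℕ) : ℤ) →
        dirIter L (k + 1) U φ = 0 → dAction U φ (perWin (d + 1) (L ^ (k + 1) * N)) = 0)
      (_hflatD : ∀ (y : Site (d + 1)) (κ μ : Fin (d + 1)), κ ≠ μ → hol (cavgIter L (k + 1) U) y (plaqWord κ μ) = 1)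
      (_hholD : ∀ i : Fin (d + 1), ∃ c : ℂ, ‖c‖ = 1 ∧
        ((hol (cavgIter L (k + 1) U) 0 (seg i (((N * m : ℕ) : ℤ))) : (Matrix n n ℂ)ˣ) : Matrix n n ℂ) = c • (1 : Matrix n n ℂ))
      (_hUP : IsPeriodicCfg U ((L ^ (k + 1) * N : ℕ) : ℤ))
      (_hθ : cruxC (d + 1) L * (((L : ℝ) ^ (k + 1)) ^ 2 * x) < 1) (_hθl : thetaLoc (d + 1) L * (((L : ℝ) ^ (k + 1)) ^ 2 * x) ≤ 1 / 2)
      (_hε : ((L : ℝ) ^ (k + 1)) ^ 2 * x ≤ 1) (_hδθ : δ ≤ θ),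
      SmallField U (K' * δ ^ 2 / ((L : ℝ) ^ (k + 1)) ^ 2) := by
  obtain ⟨K', θ, hK', hθ0, hD9⟩ := smallField_of_tanCritical_flatDatum (n := n) hd hL
  refine ⟨K', θ, hK', hθ0, ?_⟩
  intro N _ m _ k U hU x δ hx hs hUx hδ hUδ hδx hcritU hflatD hholD hUP hθ hθl hε hδθ
  choose c hc using hholD
  -- the twist exponents
  have hL0 : (0 : ℝ) < L := by exact_mod_cast (by omega : 0 < L)
  have hQ : ((N * m : ℕ) : ℝ) * (L : ℝ) ^ (k + 1) ≠ 0 := by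
    have hN : (0 : ℝ) < ((N * m : ℕ) : ℝ) := by exact_mod_cast Nat.pos_of_ne_zero (Nat.mul_ne_zero (NeZero.ne N) (NeZero.ne m))
    positivity
  set t : Fin (d + 1) → ℝ := fun i => -Complex.arg (c i) / (((N * m : ℕ) : ℝ) * (L : ℝ) ^ (k + 1)) with ht
  set a : Fin (d + 1) → ℂ := fun i => ((t i : ℝ) : ℂ) * Complex.I with ha
  have hZ := central_scalarCfg (n := n) (fun (_ : Site (d + 1)) (ν : Fin (d + 1)) => a ν)
  have hZflat := hol_scalarConst_plaqWord (n := n) a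
  -- the twisted configuration `U′ = U·z`
  have hU'u : IsUnitaryCfg (fun y μ => U y μ * scalarCfg (n := n) (fun (_ : Site (d + 1)) (ν : Fin (d + 1)) => a ν) y μ) :=
    isUnitaryCfg_mul_scalarConst_imag hU t
  have hU'x : SmallField (fun y μ => U y μ * scalarCfg (n := n) (fun (_ : Site (d + 1)) (ν : Fin (d + 1)) => a ν) y μ) x :=
    (smallField_mul_central_iff hZ hZflat x).mpr hUx
  have hU'δ : SmallField (fun y μ => U y μ * scalarCfg (n := n) (fun (_ : Site (d + 1)) (ν : Fin (d + 1)) => a ν) y μ)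
      (δ / ((L : ℝ) ^ (k + 1)) ^ 2) := (smallField_mul_central_iff hZ hZflat _).mpr hUδ
  have hU'P : IsPeriodicCfg (fun y μ => U y μ * scalarCfg (n := n) (fun (_ : Site (d + 1)) (ν : Fin (d + 1)) => a ν) y μ)
      ((L ^ (k + 1) * N : ℕ) : ℤ) := isPeriodicCfg_mul_scalarConst hUP a
  have hcritU' : ∀ φ : Site (d + 1) → Fin (d + 1) → Matrix n n ℂ, IsSkewDir φ → IsPeriodicDir φ ((L ^ (k + 1) * N : ℕ) : ℤ) →
      dirIter L (k + 1) (fun y μ => U y μ * scalarCfg (n := n) (fun (_ : Site (d + 1)) (ν : Fin (d + 1)) => a ν) y μ) φ = 0 →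
      dAction (fun y μ => U y μ * scalarCfg (n := n) (fun (_ : Site (d + 1)) (ν : Fin (d + 1)) => a ν) y μ) φ
        (perWin (d + 1) (L ^ (k + 1) * N)) = 0 := by
    intro φ hφs hφP hφT
    rw [dirIter_mul_scalarConst] at hφT
    rw [dAction_mul_central hZ hZflat]
    exact hcritU φ hφs hφP hφT
  -- the twisted datum `D′ = D·e^{M a}` is flat with trivial `(N·m)`-fold axis holonomies
  have hD' := cavgIter_mul_scalarConst (n := n) L (k + 1) U a
  have hZ' := central_scalarCfg (n := n) (fun (_ : Site (d + 1)) (ν : Fin (d + 1)) => ((L : ℂ) ^ (k + 1)) * a ν)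
  have hflatD' : ∀ (y : Site (d + 1)) (κ μ : Fin (d + 1)), κ ≠ μ →
      hol (cavgIter L (k + 1) (fun y μ => U y μ * scalarCfg (n := n) (fun (_ : Site (d + 1)) (ν : Fin (d + 1)) => a ν) y μ)) y
        (plaqWord κ μ) = 1 := by
    intro y κ μ hκμ
    rw [hD', hol_plaqWord_mul_central hZ' (hol_scalarConst_plaqWord (n := n) _)]
    exact hflatD y κ μ hκμ
  have hholD' : ∀ i : Fin (d + 1),
      hol (cavgIter L (k + 1) (fun y μ => U y μ * scalarCfg (n := n) (fun (_ : Site (d + 1)) (ν : Fin (d + 1)) => a ν) y μ)) 0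
        (seg i (((N * m : ℕ) : ℤ))) = 1 := by
    intro i
    rw [hD', hol_mul_central hZ', hol_scalarConst_seg]
    ext1
    rw [Units.val_mul, (hc i).2, val_expUnit, ← cexp_smul_one, smul_mul_smul_comm, one_mul, Units.val_one]
    have hkill := axis_holonomy_killed (hc i).1 hQ
    have harg : (((N * m : ℕ) : ℂ)) * (((L : ℂ) ^ (k + 1)) * a i)
        = ((((N * m : ℕ) : ℝ) * (L : ℝ) ^ (k + 1) : ℝ) : ℂ) * ((((-Complex.arg (c i) / (((N * m : ℕ) : ℝ) * (L : ℝ) ^ (k + 1)) : ℝ)) : ℂ) * Complex.I) := by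
      simp only [ha, ht]
      push_cast
      ring
    rw [harg, hkill, one_smul]
  have h := hD9 N m k hU'u hx hs hU'x hδ hU'δ hδx hcritU' hflatD' hholD' hU'P hθ hθl hε hδθ
  exact (smallField_mul_central_iff hZ hZflat _).mp h


/-! ## §3 The END iterated to zero on these fibres: flatness and pure gauge (the bootstrap (B) iterated over §2, as D9 §4–§5) -/

/-- **TANGENT-CRITICAL SMALL-FIELD CONFIGURATIONS ON THE FIBRE OVER A FLAT DATUM WITH FINITE-ORDER HOLONOMY MODULO THE CENTRE ARE FLAT.**  `∃ θ₀ > 0`: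
§2's hypotheses with `δ ≤ θ₀` give `SmallField U 0` (the quadratic bootstrap of §2 iterated by `NE7SmallFieldBootstrap.smallField_zero_of_bootstrap`).
[folklore] -/
theorem smallField_zero_of_tanCritical_flatDatumCentral {n : Type} [Fintype n] [DecidableEq n] [Nonempty n] (hd : 1 ≤ d) {L : ℕ} (hL : 2 ≤ L) :
    ∃ θ₀ : ℝ, 0 < θ₀ ∧ ∀ (N : ℕ) [NeZero N] (m : ℕ) [NeZero m] (k : ℕ)
      {U : Site (d + 1) → Fin (d + 1) → (Matrix n n ℂ)ˣ} (_hU : IsUnitaryCfg U) {x δ : ℝ} (_hx : 0 ≤ x) (_hs : LevelSmall (d + 1) L k x)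
      (_hUx : SmallField U x) (_hδ : 0 ≤ δ) (_hUδ : SmallField U (δ / ((L : ℝ) ^ (k + 1)) ^ 2)) (_hδx : δ / ((L : ℝ) ^ (k + 1)) ^ 2 ≤ x)
      (_hcritU : ∀ φ : Site (d + 1) → Fin (d + 1) → Matrix n n ℂ, IsSkewDir φ → IsPeriodicDir φ ((L ^ (k + 1) * N : ℕ) : ℤ) →
        dirIter L (k + 1) U φ = 0 → dAction U φ (perWin (d + 1) (L ^ (k + 1) * N)) = 0)
      (_hflatD : ∀ (y : Site (d + 1)) (κ μ : Fin (d + 1)), κ ≠ μ → hol (cavgIter L (k + 1) U) y (plaqWord κ μ) = 1)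
      (_hholD : ∀ i : Fin (d + 1), ∃ c : ℂ, ‖c‖ = 1 ∧
        ((hol (cavgIter L (k + 1) U) 0 (seg i (((N * m : ℕ) : ℤ))) : (Matrix n n ℂ)ˣ) : Matrix n n ℂ) = c • (1 : Matrix n n ℂ))
      (_hUP : IsPeriodicCfg U ((L ^ (k + 1) * N : ℕ) : ℤ))
      (_hθ : cruxC (d + 1) L * (((L : ℝ) ^ (k + 1)) ^ 2 * x) < 1) (_hθl : thetaLoc (d + 1) L * (((L : ℝ) ^ (k + 1)) ^ 2 * x) ≤ 1 / 2)
      (_hε : ((L : ℝ) ^ (k + 1)) ^ 2 * x ≤ 1) (_hδθ : δ ≤ θ₀),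
      SmallField U 0 := by
  obtain ⟨K', θ, hK', hθ0, hD11⟩ := smallField_of_tanCritical_flatDatumCentral (n := n) hd hL
  refine ⟨min θ (1 / (2 * K')), lt_min hθ0 (by positivity), ?_⟩
  intro N _ m _ k U hU x δ hx hs hUx hδ hUδ hδx hcritU hflatD hholD hUP hθ hθl hε hδθ
  have hM₂ : 0 < ((L : ℝ) ^ (k + 1)) ^ 2 := by positivity
  have hδθ' : δ ≤ θ := hδθ.trans (min_le_left _ _)
  have hKδ : K' * δ ≤ 1 / 2 := by
    have h1 : δ ≤ 1 / (2 * K') := hδθ.trans (min_le_right _ _)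
    calc K' * δ ≤ K' * (1 / (2 * K')) := mul_le_mul_of_nonneg_left h1 hK'.le
      _ = 1 / 2 := by field_simp
  refine smallField_zero_of_bootstrap (K := K') (θ := θ) hK'.le hM₂ ?_ hδ hδθ' hKδ hUδ
  intro δ' hδ' hδ'θ hUδ'
  by_cases hδ'x : δ' / ((L : ℝ) ^ (k + 1)) ^ 2 ≤ x
  · exact hD11 N m k hU hx hs hUx hδ' hUδ' hδ'x hcritU hflatD hholD hUP hθ hθl hε hδ'θ
  · have hδ'x' : x < δ' / ((L : ℝ) ^ (k + 1)) ^ 2 := not_le.mp hδ'x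
    have hxM : x = (x * ((L : ℝ) ^ (k + 1)) ^ 2) / ((L : ℝ) ^ (k + 1)) ^ 2 := by field_simp
    have hδ'' : 0 ≤ x * ((L : ℝ) ^ (k + 1)) ^ 2 := by positivity
    have hlt : x * ((L : ℝ) ^ (k + 1)) ^ 2 ≤ δ' := ((lt_div_iff₀ hM₂).mp hδ'x').le
    have hUδ'' : SmallField U ((x * ((L : ℝ) ^ (k + 1)) ^ 2) / ((L : ℝ) ^ (k + 1)) ^ 2) := by rw [← hxM]; exact hUx
    have h := hD11 N m k hU hx hs hUx hδ'' hUδ'' (by rw [← hxM]) hcritU hflatD hholD hUP hθ hθl hε (hlt.trans hδ'θ)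
    intro y κ κ' hκ
    refine (h y κ κ' hκ).trans (div_le_div_of_nonneg_right ?_ hM₂.le)
    exact mul_le_mul_of_nonneg_left (pow_le_pow_left₀ hδ'' hlt 2) hK'.le

/-- **RIGIDITY ∕ UNIQUENESS MODULO GAUGE ON THESE FIBRES.**  `∃ θ₀ > 0`: under §2's hypotheses with `δ ≤ θ₀` the configuration is a PURE GAUGE on `ℤ^{d+1}`:
`∃ g` unitary with `U = 1^{g}` (zero curvature ⇒ pure gauge, `NE3EnergyRateFlatClass.exists_unitary_gauge_eq_gaugeAct_flatCfg`). [folklore] -/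
theorem exists_pureGauge_of_tanCritical_flatDatumCentral {n : Type} [Fintype n] [DecidableEq n] [Nonempty n] (hd : 1 ≤ d) {L : ℕ} (hL : 2 ≤ L) :
    ∃ θ₀ : ℝ, 0 < θ₀ ∧ ∀ (N : ℕ) [NeZero N] (m : ℕ) [NeZero m] (k : ℕ)
      {U : Site (d + 1) → Fin (d + 1) → (Matrix n n ℂ)ˣ} (_hU : IsUnitaryCfg U) {x δ : ℝ} (_hx : 0 ≤ x) (_hs : LevelSmall (d + 1) L k x)
      (_hUx : SmallField U x) (_hδ : 0 ≤ δ) (_hUδ : SmallField U (δ / ((L : ℝ) ^ (k + 1)) ^ 2)) (_hδx : δ / ((L : ℝ) ^ (k + 1)) ^ 2 ≤ x)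
      (_hcritU : ∀ φ : Site (d + 1) → Fin (d + 1) → Matrix n n ℂ, IsSkewDir φ → IsPeriodicDir φ ((L ^ (k + 1) * N : ℕ) : ℤ) →
        dirIter L (k + 1) U φ = 0 → dAction U φ (perWin (d + 1) (L ^ (k + 1) * N)) = 0)
      (_hflatD : ∀ (y : Site (d + 1)) (κ μ : Fin (d + 1)), κ ≠ μ → hol (cavgIter L (k + 1) U) y (plaqWord κ μ) = 1)
      (_hholD : ∀ i : Fin (d + 1), ∃ c : ℂ, ‖c‖ = 1 ∧
        ((hol (cavgIter L (k + 1) U) 0 (seg i (((N * m : ℕ) : ℤ))) : (Matrix n n ℂ)ˣ) : Matrix n n ℂ) = c • (1 : Matrix n n ℂ))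
      (_hUP : IsPeriodicCfg U ((L ^ (k + 1) * N : ℕ) : ℤ))
      (_hθ : cruxC (d + 1) L * (((L : ℝ) ^ (k + 1)) ^ 2 * x) < 1) (_hθl : thetaLoc (d + 1) L * (((L : ℝ) ^ (k + 1)) ^ 2 * x) ≤ 1 / 2)
      (_hε : ((L : ℝ) ^ (k + 1)) ^ 2 * x ≤ 1) (_hδθ : δ ≤ θ₀),
      ∃ g : Site (d + 1) → (Matrix n n ℂ)ˣ, IsUnitarySite g ∧ U = gaugeAct g flat := by
  obtain ⟨θ₀, hθ₀, hflat⟩ := smallField_zero_of_tanCritical_flatDatumCentral (n := n) hd hL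
  refine ⟨θ₀, hθ₀, ?_⟩
  intro N _ m _ k U hU x δ hx hs hUx hδ hUδ hδx hcritU hflatD hholD hUP hθ hθl hε hδθ
  have h0 := hflat N m k hU hx hs hUx hδ hUδ hδx hcritU hflatD hholD hUP hθ hθl hε hδθ
  obtain ⟨g, hgu, hUg⟩ := exists_unitary_gauge_eq_gaugeAct_flatCfg hU (hol_plaqWord_eq_one_of_smallField_zero h0)
  exact ⟨g, hgu, hUg⟩


/-! ## §4 The same, stated on the period-`N` axis holonomies: `D([0,N e_i])^m` scalar (finite order `m` modulo the centre) -/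

/-- **(APE) ON THE FIBRE OVER A FLAT DATUM WHOSE HOLONOMY HAS FINITE ORDER `m` MODULO THE CENTRE** — §2 with the hypothesis put on the period-`N`
axis holonomies `h_i = D([0,N e_i])` of the datum `D = cavgIter L (k+1) U`: `h_i^m = c_i·1`, `|c_i| = 1`.  Same `∃ K′ θ` clause as the OWNER's D8.
[folklore] -/
theorem smallField_of_tanCritical_flatDatumPU {n : Type} [Fintype n] [DecidableEq n] [Nonempty n] (hd : 1 ≤ d) {L : ℕ} (hL : 2 ≤ L) :
    ∃ K' θ : ℝ, 0 < K' ∧ 0 < θ ∧ ∀ (N : ℕ) [NeZero N] (m : ℕ) [NeZero m] (k : ℕ)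
      {U : Site (d + 1) → Fin (d + 1) → (Matrix n n ℂ)ˣ} (_hU : IsUnitaryCfg U) {x δ : ℝ} (_hx : 0 ≤ x) (_hs : LevelSmall (d + 1) L k x)
      (_hUx : SmallField U x) (_hδ : 0 ≤ δ) (_hUδ : SmallField U (δ / ((L : ℝ) ^ (k + 1)) ^ 2)) (_hδx : δ / ((L : ℝ) ^ (k + 1)) ^ 2 ≤ x)
      (_hcritU : ∀ φ : Site (d + 1) → Fin (d + 1) → Matrix n n ℂ, IsSkewDir φ → IsPeriodicDir φ ((L ^ (k + 1) * N : ℕ) : ℤ) →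
        dirIter L (k + 1) U φ = 0 → dAction U φ (perWin (d + 1) (L ^ (k + 1) * N)) = 0)
      (_hflatD : ∀ (y : Site (d + 1)) (κ μ : Fin (d + 1)), κ ≠ μ → hol (cavgIter L (k + 1) U) y (plaqWord κ μ) = 1)
      (_hholD : ∀ i : Fin (d + 1), ∃ c : ℂ, ‖c‖ = 1 ∧
        (((hol (cavgIter L (k + 1) U) 0 (seg i (N : ℤ)) ^ m : (Matrix n n ℂ)ˣ)) : Matrix n n ℂ) = c • (1 : Matrix n n ℂ))
      (_hUP : IsPeriodicCfg U ((L ^ (k + 1) * N : ℕ) : ℤ))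
      (_hθ : cruxC (d + 1) L * (((L : ℝ) ^ (k + 1)) ^ 2 * x) < 1) (_hθl : thetaLoc (d + 1) L * (((L : ℝ) ^ (k + 1)) ^ 2 * x) ≤ 1 / 2)
      (_hε : ((L : ℝ) ^ (k + 1)) ^ 2 * x ≤ 1) (_hδθ : δ ≤ θ),
      SmallField U (K' * δ ^ 2 / ((L : ℝ) ^ (k + 1)) ^ 2) := by
  obtain ⟨K', θ, hK', hθ0, hD11⟩ := smallField_of_tanCritical_flatDatumCentral (n := n) hd hL
  refine ⟨K', θ, hK', hθ0, ?_⟩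
  intro N _ m _ k U hU x δ hx hs hUx hδ hUδ hδx hcritU hflatD hholD hUP hθ hθl hε hδθ
  have hDP : IsPeriodicCfg (cavgIter L (k + 1) U) (N : ℤ) := by
    refine isPeriodicCfg_cavgIter L N (k + 1) ?_
    rw [tower_eq_pow_mul]
    exact hUP
  have hholD' : ∀ i : Fin (d + 1), ∃ c : ℂ, ‖c‖ = 1 ∧
      ((hol (cavgIter L (k + 1) U) 0 (seg i (((N * m : ℕ) : ℤ))) : (Matrix n n ℂ)ˣ) : Matrix n n ℂ) = c • (1 : Matrix n n ℂ) := by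
    intro i
    rw [hol_seg_mul_eq_pow hDP i m]
    exact hholD i
  exact hD11 N m k hU hx hs hUx hδ hUδ hδx hcritU hflatD hholD' hUP hθ hθl hε hδθ

/-- **RIGIDITY on the same fibres** (§3 with §4's hypothesis): tangent-critical, small field `δ ≤ θ₀`, flat datum with `D([0,N e_i])^m` scalar ⟹ `U = 1^{g}`,
`g` unitary. [folklore] -/
theorem exists_pureGauge_of_tanCritical_flatDatumPU {n : Type} [Fintype n] [DecidableEq n] [Nonempty n] (hd : 1 ≤ d) {L : ℕ} (hL : 2 ≤ L) :
    ∃ θ₀ : ℝ, 0 < θ₀ ∧ ∀ (N : ℕ) [NeZero N] (m : ℕ) [NeZero m] (k : ℕ)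
      {U : Site (d + 1) → Fin (d + 1) → (Matrix n n ℂ)ˣ} (_hU : IsUnitaryCfg U) {x δ : ℝ} (_hx : 0 ≤ x) (_hs : LevelSmall (d + 1) L k x)
      (_hUx : SmallField U x) (_hδ : 0 ≤ δ) (_hUδ : SmallField U (δ / ((L : ℝ) ^ (k + 1)) ^ 2)) (_hδx : δ / ((L : ℝ) ^ (k + 1)) ^ 2 ≤ x)
      (_hcritU : ∀ φ : Site (d + 1) → Fin (d + 1) → Matrix n n ℂ, IsSkewDir φ → IsPeriodicDir φ ((L ^ (k + 1) * N : ℕ) : ℤ) →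
        dirIter L (k + 1) U φ = 0 → dAction U φ (perWin (d + 1) (L ^ (k + 1) * N)) = 0)
      (_hflatD : ∀ (y : Site (d + 1)) (κ μ : Fin (d + 1)), κ ≠ μ → hol (cavgIter L (k + 1) U) y (plaqWord κ μ) = 1)
      (_hholD : ∀ i : Fin (d + 1), ∃ c : ℂ, ‖c‖ = 1 ∧
        (((hol (cavgIter L (k + 1) U) 0 (seg i (N : ℤ)) ^ m : (Matrix n n ℂ)ˣ)) : Matrix n n ℂ) = c • (1 : Matrix n n ℂ))
      (_hUP : IsPeriodicCfg U ((L ^ (k + 1) * N : ℕ) : ℤ))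
      (_hθ : cruxC (d + 1) L * (((L : ℝ) ^ (k + 1)) ^ 2 * x) < 1) (_hθl : thetaLoc (d + 1) L * (((L : ℝ) ^ (k + 1)) ^ 2 * x) ≤ 1 / 2)
      (_hε : ((L : ℝ) ^ (k + 1)) ^ 2 * x ≤ 1) (_hδθ : δ ≤ θ₀),
      ∃ g : Site (d + 1) → (Matrix n n ℂ)ˣ, IsUnitarySite g ∧ U = gaugeAct g flat := by
  obtain ⟨θ₀, hθ₀, hD11⟩ := exists_pureGauge_of_tanCritical_flatDatumCentral (n := n) hd hL
  refine ⟨θ₀, hθ₀, ?_⟩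
  intro N _ m _ k U hU x δ hx hs hUx hδ hUδ hδx hcritU hflatD hholD hUP hθ hθl hε hδθ
  have hDP : IsPeriodicCfg (cavgIter L (k + 1) U) (N : ℤ) := by
    refine isPeriodicCfg_cavgIter L N (k + 1) ?_
    rw [tower_eq_pow_mul]
    exact hUP
  have hholD' : ∀ i : Fin (d + 1), ∃ c : ℂ, ‖c‖ = 1 ∧
      ((hol (cavgIter L (k + 1) U) 0 (seg i (((N * m : ℕ) : ℤ))) : (Matrix n n ℂ)ˣ) : Matrix n n ℂ) = c • (1 : Matrix n n ℂ) := by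
    intro i
    rw [hol_seg_mul_eq_pow hDP i m]
    exact hholD i
  exact hD11 N m k hU hx hs hUx hδ hUδ hδx hcritU hflatD hholD' hUP hθ hθl hε hδθ


/-! ## §5 The abelian case `U(1)`: every holonomy is a scalar, so the END holds over EVERY flat datum -/

/-- For `1 × 1` matrices every unitary unit is a unimodular scalar multiple of `1`. [folklore] -/
theorem exists_eq_smul_one_of_unique [Unique n] {u : (Matrix n n ℂ)ˣ} (hu : u ∈ unitaryUnits (Matrix n n ℂ)) :
    ∃ c : ℂ, ‖c‖ = 1 ∧ (u : Matrix n n ℂ) = c • (1 : Matrix n n ℂ) := by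
  have hmat : (u : Matrix n n ℂ) = (u : Matrix n n ℂ) default default • (1 : Matrix n n ℂ) := by
    ext i j
    rw [Subsingleton.elim i default, Subsingleton.elim j default, Matrix.smul_apply, Matrix.one_apply_eq, smul_eq_mul, mul_one]
  refine ⟨(u : Matrix n n ℂ) default default, ?_, hmat⟩
  have h1 : ‖(u : Matrix n n ℂ)‖ = 1 := CStarRing.norm_of_mem_unitary (mem_unitaryUnits.1 hu)
  rw [hmat, norm_smul, CStarRing.norm_one, mul_one] at h1
  exact h1

/-- **`U(1)`: THE (APE) END ON THE FIBRE OVER EVERY FLAT DATUM** (`n` a one-element index type, so every axis holonomy is a unimodular scalar and §2 applies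
with `m = 1`): D9 §3's hypotheses WITHOUT any holonomy condition, SAME `∃ K′ θ` clause as the OWNER's D8. [folklore] -/
theorem smallField_of_tanCritical_flatDatum_abelian {n : Type} [Fintype n] [DecidableEq n] [Unique n] (hd : 1 ≤ d) {L : ℕ} (hL : 2 ≤ L) :
    ∃ K' θ : ℝ, 0 < K' ∧ 0 < θ ∧ ∀ (N : ℕ) [NeZero N] (k : ℕ)
      {U : Site (d + 1) → Fin (d + 1) → (Matrix n n ℂ)ˣ} (_hU : IsUnitaryCfg U) {x δ : ℝ} (_hx : 0 ≤ x) (_hs : LevelSmall (d + 1) L k x)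
      (_hUx : SmallField U x) (_hδ : 0 ≤ δ) (_hUδ : SmallField U (δ / ((L : ℝ) ^ (k + 1)) ^ 2)) (_hδx : δ / ((L : ℝ) ^ (k + 1)) ^ 2 ≤ x)
      (_hcritU : ∀ φ : Site (d + 1) → Fin (d + 1) → Matrix n n ℂ, IsSkewDir φ → IsPeriodicDir φ ((L ^ (k + 1) * N : ℕ) : ℤ) →
        dirIter L (k + 1) U φ = 0 → dAction U φ (perWin (d + 1) (L ^ (k + 1) * N)) = 0)
      (_hflatD : ∀ (y : Site (d + 1)) (κ μ : Fin (d + 1)), κ ≠ μ → hol (cavgIter L (k + 1) U) y (plaqWord κ μ) = 1)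
      (_hUP : IsPeriodicCfg U ((L ^ (k + 1) * N : ℕ) : ℤ))
      (_hθ : cruxC (d + 1) L * (((L : ℝ) ^ (k + 1)) ^ 2 * x) < 1) (_hθl : thetaLoc (d + 1) L * (((L : ℝ) ^ (k + 1)) ^ 2 * x) ≤ 1 / 2)
      (_hε : ((L : ℝ) ^ (k + 1)) ^ 2 * x ≤ 1) (_hδθ : δ ≤ θ),
      SmallField U (K' * δ ^ 2 / ((L : ℝ) ^ (k + 1)) ^ 2) := by
  obtain ⟨K', θ, hK', hθ0, hD11⟩ := smallField_of_tanCritical_flatDatumCentral (n := n) hd hL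
  refine ⟨K', θ, hK', hθ0, ?_⟩
  intro N _ k U hU x δ hx hs hUx hδ hUδ hδx hcritU hflatD hUP hθ hθl hε hδθ
  have hL1 : 1 ≤ L := by omega
  haveI : NeZero (1 : ℕ) := ⟨one_ne_zero⟩
  have hDu : IsUnitaryCfg (cavgIter L (k + 1) U) := (cavgIter_unitary_small hL1 k hU hx hs hUx).1
  have hholD : ∀ i : Fin (d + 1), ∃ c : ℂ, ‖c‖ = 1 ∧
      ((hol (cavgIter L (k + 1) U) 0 (seg i (((N * 1 : ℕ) : ℤ))) : (Matrix n n ℂ)ˣ) : Matrix n n ℂ) = c • (1 : Matrix n n ℂ) :=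
    fun i => exists_eq_smul_one_of_unique (hol_mem_of hDu 0 _)
  exact hD11 N 1 k hU hx hs hUx hδ hUδ hδx hcritU hflatD hholD hUP hθ hθl hε hδθ


/-- **`U(1)`: RIGIDITY ON THE FIBRE OVER EVERY FLAT DATUM** — `∃ θ₀ > 0`: a tangent-critical configuration of the small-field class with `δ ≤ θ₀` on the fibre
over ANY flat datum is a pure gauge `1^{g}` (§3 with `m = 1`; every `1 × 1` holonomy is a unimodular scalar). [folklore] -/
theorem exists_pureGauge_of_tanCritical_flatDatum_abelian {n : Type} [Fintype n] [DecidableEq n] [Unique n] (hd : 1 ≤ d) {L : ℕ} (hL : 2 ≤ L) :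
    ∃ θ₀ : ℝ, 0 < θ₀ ∧ ∀ (N : ℕ) [NeZero N] (k : ℕ)
      {U : Site (d + 1) → Fin (d + 1) → (Matrix n n ℂ)ˣ} (_hU : IsUnitaryCfg U) {x δ : ℝ} (_hx : 0 ≤ x) (_hs : LevelSmall (d + 1) L k x)
      (_hUx : SmallField U x) (_hδ : 0 ≤ δ) (_hUδ : SmallField U (δ / ((L : ℝ) ^ (k + 1)) ^ 2)) (_hδx : δ / ((L : ℝ) ^ (k + 1)) ^ 2 ≤ x)
      (_hcritU : ∀ φ : Site (d + 1) → Fin (d + 1) → Matrix n n ℂ, IsSkewDir φ → IsPeriodicDir φ ((L ^ (k + 1) * N : ℕ) : ℤ) →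
        dirIter L (k + 1) U φ = 0 → dAction U φ (perWin (d + 1) (L ^ (k + 1) * N)) = 0)
      (_hflatD : ∀ (y : Site (d + 1)) (κ μ : Fin (d + 1)), κ ≠ μ → hol (cavgIter L (k + 1) U) y (plaqWord κ μ) = 1)
      (_hUP : IsPeriodicCfg U ((L ^ (k + 1) * N : ℕ) : ℤ))
      (_hθ : cruxC (d + 1) L * (((L : ℝ) ^ (k + 1)) ^ 2 * x) < 1) (_hθl : thetaLoc (d + 1) L * (((L : ℝ) ^ (k + 1)) ^ 2 * x) ≤ 1 / 2)
      (_hε : ((L : ℝ) ^ (k + 1)) ^ 2 * x ≤ 1) (_hδθ : δ ≤ θ₀),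
      ∃ g : Site (d + 1) → (Matrix n n ℂ)ˣ, IsUnitarySite g ∧ U = gaugeAct g flat := by
  obtain ⟨θ₀, hθ₀, hD11⟩ := exists_pureGauge_of_tanCritical_flatDatumCentral (n := n) hd hL
  refine ⟨θ₀, hθ₀, ?_⟩
  intro N _ k U hU x δ hx hs hUx hδ hUδ hδx hcritU hflatD hUP hθ hθl hε hδθ
  have hL1 : 1 ≤ L := by omega
  haveI : NeZero (1 : ℕ) := ⟨one_ne_zero⟩
  have hDu : IsUnitaryCfg (cavgIter L (k + 1) U) := (cavgIter_unitary_small hL1 k hU hx hs hUx).1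
  have hholD : ∀ i : Fin (d + 1), ∃ c : ℂ, ‖c‖ = 1 ∧
      ((hol (cavgIter L (k + 1) U) 0 (seg i (((N * 1 : ℕ) : ℤ))) : (Matrix n n ℂ)ˣ) : Matrix n n ℂ) = c • (1 : Matrix n n ℂ) :=
    fun i => exists_eq_smul_one_of_unique (hol_mem_of hDu 0 _)
  exact hD11 N 1 k hU hx hs hUx hδ hUδ hδx hcritU hflatD hholD hUP hθ hθl hε hδθ

end

end Summit.QuantumFields.BalabanUV.T4Continuum.NE7ApeFlatToronCentralEnd
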